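import Mathlib.Topology.Algebra.ClopenNhdofOne
import Mathlib.Topology.Algebra.OpenSubgroup
import Mathlib.Topology.Algebra.Group.Pointwise
import Mathlib.Algebra.Group.Subgroup.Pointwise
import Mathlib.Algebra.Group.Pointwise.Set.Basic
import Literature.GroupTheory.ProPPowerMap
import HarnessLib

/-!
# Profinite groups: closure through the open normal subgroups; finite width is detected by the finite
# quotients

Dixon–du Sautoy–Mann–Segal, *Analytic pro-p groups* (2nd ed., Cambridge 1999), Chapter 1:

* **Proposition 1.2 (iii)**: "For any subset `X` of [a profinite group] `G`, `X̄ = ⋂_{N ◁_o G} XN`"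
  — `closure_eq_iInter_mul_openNormalSubgroup` (and the `NX` form
  `closure_eq_iInter_openNormalSubgroup_mul`); in particular an element lying in `XN` for every open
  normal `N` lies in `X̄`, so in `X` when `X` is closed (`mem_of_forall_mem_openNormalSubgroup_mul`;
  the `XN` form for closed `X` is abc-iut-w5-d218's `mem_of_forall_mem_mul_openNormalSubgroup` in
  `ProPPowerMap.lean`, imported; this is the deduction pattern of Ch. 1 Exercise 6 (ii): "if
  `g ≡ w(x₁(N), …, xₙ(N)) (mod N)` for every `N ◁_o G` then `g = w(x₁, …, xₙ)`", `w(G)` being closed);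
* **Exercise 18 (ii)**: for a closed subset `S` of a profinite group, with
  `S⁽ⁿ⁾ = {x₁ ⋯ xₙ ∣ xᵢ ∈ S}` and `S^∞ = ⋃ₙ S⁽ⁿ⁾`: "`S^∞ = S⁽ⁿ⁾` if and only if `N S^∞ = N S⁽ⁿ⁾` for every
  `N ◁_o G`" — `iUnion_pow_eq_pow_iff_forall_openNormalSubgroup` (FINITE WIDTH IS DETECTED BY THE
  FINITE QUOTIENTS `G/N`: `N S⁽ⁿ⁾ ⊇ N S^∞` says that in `G/N` every product of elements of `S̄` is a
  product of `n` of them).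
[cite: DDMSAnalyticProP1999, Prop 1.2 (iii); Ch.1 Exercise 18 (ii)]

Mathlib-only; "profinite" = compact, totally disconnected topological group (open normal subgroups
then form a neighbourhood basis of `1`: `ProfiniteGrp.exist_openNormalSubgroup_sub_open_nhds_of_one`).
PROOF-ONLY file (no definition, no named fact).  Companion of `BaireCountableIndexOpen.lean` (Ex. 18
(i): `S^∞` closed ⟺ finite width).  Nothing here is specific to, or takes a side on, inter-universal
Teichmüller theory or [IUTchIII] Cor. 3.12.
-/

namespace Literature.GroupTheory

open scoped _root_.Topology _root_.Pointwise
open _root_.Set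

variable {G : Type*} [Group G] [TopologicalSpace G] [IsTopologicalGroup G]

/-! ### DDMS Prop. 1.2 (iii): `X̄ = ⋂_{N ◁_o G} XN` -/

/-- One inclusion of [DDMS] Prop. 1.2 (iii), valid in any topological group: the closure of `X` is
contained in `X N` for every open subgroup `N` (if `y ∈ X̄`, the open coset `yN` meets `X` in some
`x = yn`, so `y = xn⁻¹ ∈ XN`). [cite: DDMSAnalyticProP1999, Prop 1.2 (iii)] -/
theorem closure_subset_mul_of_isOpen (X : Set G) (N : Subgroup G) (hN : IsOpen (N : Set G)) :
    closure X ⊆ X * (N : Set G) := by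
  intro y hy
  rw [mem_closure_iff] at hy
  have hyo : y ∈ y • (N : Set G) := mem_smul_set.mpr ⟨1, N.one_mem, by simp⟩
  obtain ⟨x, hxo, hxX⟩ := hy (y • (N : Set G)) (hN.smul y) hyo
  obtain ⟨n, hn, rfl⟩ := mem_smul_set.mp hxo
  refine mem_mul.mpr ⟨y • n, hxX, n⁻¹, N.inv_mem hn, ?_⟩
  simp [smul_eq_mul]

/-- Left form: the closure of `X` is contained in `N X` for every open subgroup `N`.
[cite: DDMSAnalyticProP1999, Prop 1.2 (iii)] -/
theorem closure_subset_mul_of_isOpen_left (X : Set G) (N : Subgroup G) (hN : IsOpen (N : Set G)) :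
    closure X ⊆ (N : Set G) * X := by
  intro y hy
  -- apply the right form in the opposite direction via inversion
  have hy' : y⁻¹ ∈ closure X⁻¹ := by
    rw [← inv_closure]; exact Set.inv_mem_inv.mpr hy
  have h := closure_subset_mul_of_isOpen X⁻¹ N hN hy'
  have h2 : y ∈ (X⁻¹ * (N : Set G))⁻¹ := Set.mem_inv.mpr h
  rwa [mul_inv_rev, inv_inv, inv_coe_set] at h2

/-- Powers of a compact set are compact. [folklore] -/
private theorem isCompact_pow' {S : Set G} (hS : IsCompact S) : ∀ n : ℕ, IsCompact (S ^ n)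
  | 0 => by rw [pow_zero]; exact isCompact_singleton
  | n + 1 => by rw [pow_succ]; exact (isCompact_pow' hS n).mul hS

section Profinite

variable [CompactSpace G] [TotallyDisconnectedSpace G]

/-- **[DDMS] Proposition 1.2 (iii).** In a profinite group, `X̄ = ⋂_{N ◁_o G} X N` for every subset
`X`. [cite: DDMSAnalyticProP1999, Prop 1.2 (iii)] -/
theorem closure_eq_iInter_mul_openNormalSubgroup (X : Set G) :
    closure X = ⋂ N : OpenNormalSubgroup G, X * ((N : Subgroup G) : Set G) := by
  apply Subset.antisymm
  · exact subset_iInter fun N => closure_subset_mul_of_isOpen X N N.isOpen'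
  · intro y hy
    rw [mem_iInter] at hy
    rw [mem_closure_iff]
    intro o ho hyo
    -- `{g | y * g ∈ o}` is an open neighbourhood of `1`; choose `N ◁_o G` inside it
    have ho' : IsOpen ((fun g => y * g) ⁻¹' o) := ho.preimage (continuous_const_mul y)
    obtain ⟨N, hN⟩ :=
      ProfiniteGrp.exist_openNormalSubgroup_sub_open_nhds_of_one ho' (by simpa using hyo)
    obtain ⟨x, hx, n, hn, hxn⟩ := mem_mul.mp (hy N)
    refine ⟨x, ?_, hx⟩
    have hmem : n⁻¹ ∈ (fun g => y * g) ⁻¹' o := hN ((N : Subgroup G).inv_mem hn)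
    have : y * n⁻¹ = x := by rw [← hxn, mul_inv_cancel_right]
    simpa [this] using hmem

/-- **[DDMS] Proposition 1.2 (iii), left form.** In a profinite group, `X̄ = ⋂_{N ◁_o G} N X`.
[cite: DDMSAnalyticProP1999, Prop 1.2 (iii)] -/
theorem closure_eq_iInter_openNormalSubgroup_mul (X : Set G) :
    closure X = ⋂ N : OpenNormalSubgroup G, ((N : Subgroup G) : Set G) * X := by
  rw [closure_eq_iInter_mul_openNormalSubgroup]
  refine iInter_congr fun N => ?_
  haveI : (N : Subgroup G).Normal := N.isNormal'
  exact Subgroup.set_mul_normal_comm X (N : Subgroup G)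

/-- In a profinite group, an element lying in `N X` for every open normal subgroup `N` lies in the
closure of `X`; for CLOSED `X` it lies in `X` — the deduction pattern of [DDMS] Ch. 1 Exercise 6 (ii)
("if `g ≡ w(x₁(N),…,xₙ(N)) (mod N)` for every `N ◁_o G`, then `g = w(x₁,…,xₙ)`", `w(G)` being closed).
The `X N` form for closed `X` is already in the tree:
`Literature.GroupTheory.mem_of_forall_mem_mul_openNormalSubgroup` (`ProPPowerMap.lean`).
[cite: DDMSAnalyticProP1999, Prop 1.2 (iii)] -/
theorem mem_of_forall_mem_openNormalSubgroup_mul {X : Set G} (hX : IsClosed X) {g : G}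
    (hg : ∀ N : OpenNormalSubgroup G, g ∈ ((N : Subgroup G) : Set G) * X) : g ∈ X := by
  rw [← hX.closure_eq, closure_eq_iInter_openNormalSubgroup_mul]
  exact mem_iInter.mpr hg

/-! ### DDMS Ch. 1 Exercise 18 (ii): finite width is detected by the finite quotients -/

/-- **[DDMS] Ch. 1 Exercise 18 (ii).** Let `S` be a closed subset of a profinite group, `S⁽ⁿ⁾ = S ^ n`
the set of products of `n` elements of `S` and `S^∞ = ⋃ₙ S⁽ⁿ⁾`.  Then `S^∞ = S⁽ⁿ⁾` if and only if
`N S^∞ = N S⁽ⁿ⁾` for every open normal subgroup `N` — i.e. `S` has width `n` in `G` iff it has width `n`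
in every finite quotient `G/N`.  ("If": an element of `S^∞` lies in `N S⁽ⁿ⁾` for every `N`, hence in the
closed set `S⁽ⁿ⁾` by Prop. 1.2 (iii).) [cite: DDMSAnalyticProP1999, Ch.1 Exercise 18 (ii)] -/
theorem iUnion_pow_eq_pow_iff_forall_openNormalSubgroup [T2Space G] {S : Set G} (hS : IsClosed S)
    (n : ℕ) :
    (⋃ k : ℕ, S ^ k) = S ^ n ↔
      ∀ N : OpenNormalSubgroup G,
        ((N : Subgroup G) : Set G) * (⋃ k : ℕ, S ^ k) = ((N : Subgroup G) : Set G) * S ^ n := by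
  refine ⟨fun h N => by rw [h], fun h => ?_⟩
  refine Subset.antisymm (fun x hx => ?_) (subset_iUnion (fun k => S ^ k) n)
  have hclosed : IsClosed (S ^ n) := (isCompact_pow' hS.isCompact n).isClosed
  refine mem_of_forall_mem_openNormalSubgroup_mul hclosed fun N => ?_
  rw [← h N]
  exact mem_mul.mpr ⟨1, (N : Subgroup G).one_mem, x, hx, one_mul x⟩

/-- **Width is detected by the finite quotients, `∃`-form.** For a closed subset `S` of a profinite
group: `S^∞ = ⋃ₙ S ^ n` has finite width (`= S ^ n` for some `n`) iff there is ONE `n` that is a width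
bound modulo every open normal subgroup.  Combined with Ch. 1 Ex. 18 (i)
(`isClosed_iUnion_pow_iff_exists_eq_pow`, file `BaireCountableIndexOpen.lean`): for symmetric
`S ∋ 1`, the abstract subgroup `⟨S⟩` is CLOSED iff a UNIFORM width bound holds in all finite quotients.
[cite: DDMSAnalyticProP1999, Ch.1 Exercise 18 (ii)] -/
theorem exists_iUnion_pow_eq_pow_iff_forall_openNormalSubgroup [T2Space G] {S : Set G}
    (hS : IsClosed S) :
    (∃ n : ℕ, (⋃ k : ℕ, S ^ k) = S ^ n) ↔
      ∃ n : ℕ, ∀ N : OpenNormalSubgroup G,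
        ((N : Subgroup G) : Set G) * (⋃ k : ℕ, S ^ k) = ((N : Subgroup G) : Set G) * S ^ n :=
  exists_congr fun n => iUnion_pow_eq_pow_iff_forall_openNormalSubgroup hS n

end Profinite

end Literature.GroupTheory
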